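import Literature.Computation.Certificates.PosSemidefInt
import Literature.Computation.Certificates.Data
import Literature.Computation.Certificates.Blocks

/-!
# List-refined integer Gram certificates (data refinement of `PSD.IsGramCertZ`)

Compute-infrastructure file, a companion of `PosSemidefInt.lean` and `Data.lean` (ladder
GRIDFUSION, director RULING 14 AM9 / lever «L3»). The certificate predicate
`PSD.IsGramCertZ A d B` («the integer residual `A − Bᵀ·diag d·B` is symmetric diagonally dominant»)
is DECIDED in `PosSemidefInt.lean` through its `Finset`-sum definition: every residual entry is a
`∑ k : Fin m, …` re-expanded by the kernel wherever it occurs (twice for symmetry, once for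
dominance), through the generic `Finset`/`Multiset`/`Fin` machinery. This file performs the
standard DATA REFINEMENT step of certified numerical checkers (CoqEAL; the ValidSDP positivity
checker: «specialize the algorithms with effective datatypes and prove them correct with respect
to the proof-oriented datatypes») for this predicate: the same check is computed by plain
structural recursion over `List ℤ` data, each residual entry exactly once, and a once-proved lemma
transports a successful list check to `PSD.IsGramCertZ` — so every consumer
(`IsGramCertZ.posSemidef`, `.quadForm_nonneg`, `.posSemidef_of_smul`, `GramSOS.quadNonneg_of_gramCertZ`)
applies unchanged, and the rows can still be split with `forall_fin_of_blocks` (`Blocks.lean`).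

Data layout (what an emitter writes, all plain `List` literals, cf. `Data.lean`):
* `Arows : List (List ℤ)` — the `n` rows of the integer matrix `A`;
* `d : List ℕ` — the `m` weights;
* `BT : List (List ℤ)` — the `n` COLUMNS of the factor `B` (i.e. the rows of `Bᵀ`), each of
  length `m`; the matrix they denote is `matrixOfCols m n BT : Matrix (Fin m) (Fin n) ℤ`.
Missing entries default to `0` exactly as in `matrixOfRows` / `vecOfList` (the fuel-indexed
recursions below reproduce the `List.getD … 0` semantics, so NO length side condition is needed).

## API (namespace `Literature.Computation.Certificates`, `….PSD`)

* `matrixOfCols m n cols` (+ `matrixOfCols_apply`);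
* `PSD.ldotZ m u v` (`= ∑ k : Fin m, u.getD k 0 * v.getD k 0`), `PSD.lwmulZ d u`
  (`(lwmulZ d u).getD k 0 = d.getD k 0 * u.getD k 0`) — the bridging lemmas are file-private;
* `PSD.rowAccZ`, `PSD.rowCheckZ n m Arows d BT i : Bool` — row `i` of the residual is computed once
  and `∑_{j ≠ i} |R i j| ≤ R i i` is tested as `∑_j (if j = i then −R i j else |R i j|) ≤ 0`;
* **`PSD.IsGramCertZ.of_listCheck`**: symmetry of `A` (as the `Fin`-statement over `matrixOfRows`)
  and `∀ i : Fin n, rowCheckZ n m Arows d BT i.val = true` imply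
  `IsGramCertZ (matrixOfRows n n Arows) (vecOfList m d) (matrixOfCols m n BT)`;
* `PSD.symCheckZ n Arows : Bool` (transpose once by `colsN`, compare row lists) with
  `symm_of_symCheckZ`, and **`PSD.IsGramCertZ.of_listCheck'`** taking `symCheckZ … = true` instead
  of the `Fin`-statement (whose direct decision walks `List.getD` twice per pair).
* Usage template and kernel-checked tests at the end.

Cost: `n²·m + n·m` integer multiplications per certificate (vs `≈ 3·n²·m` plus `Finset`
unfolding for the direct instance), no `ℚ` normalisation; memory per `decide` as in `Blocks.lean`.
Measured (farm, `decide +kernel`, 2026-08-26, dense synthetic data `n = m = s`, 6-digit factor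
`B`, weights `≤ 9`, 13-digit `A`; kernel time = wall minus the file's own elaboration):
`s = 84`: all rows in ONE `decide` ≈ 75–80 s (the same in 7 blocks of 12), `symCheckZ` ≈ 1 s, the
`Fin`-form symmetry of `A` ≈ 13 s — versus ≈ 100 s for the dominance rows ALONE of the direct
instance already at `s = 60` (6 blocks; its symmetry conjunct costs about twice that again), where
the list form takes 27 s all told; `s = 120`: one `decide` exceeds the kernel memory cap, 6 blocks
of 20 rows pass in ≈ 5.5 min of kernel time.

References: the refinement methodology is [cite: MartinDorelRoux2017, §3] (É. Martin-Dorel, P. Roux,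
*A reflexive tactic for polynomial positivity using numerical solvers and floating-point
computations*, CPP 2017, §3 «Verification of effective computation using data refinement») after
CoqEAL (C. Cohen, M. Dénès, A. Mörtberg, *Refinements for free!*, CPP 2013); the mathematics
(Gershgorin / diagonal dominance of the rounded-Gram residual) is that of `PosSemidefInt.lean`
[folklore; Blekherman–Parrilo–Thomas 2012, App. A.1.2].
-/

namespace Literature.Computation.Certificates

/-- An `m × n` matrix read from a list of its COLUMNS (default `0` past the end of a column or of
the column list): `matrixOfCols m n cols k i = (cols.getD i []).getD k 0`. [folklore] -/
def matrixOfCols {α : Type*} [Zero α] (m n : ℕ) (cols : List (List α)) :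
    Matrix (Fin m) (Fin n) α :=
  fun k i => (cols.getD i.val []).getD k.val 0

/-- `matrixOfCols` unfolds to two `List.getD`s — the accessor of the list-of-lists effective
matrix carrier («effective matrices based on lists of lists»). [cite: MartinDorelRoux2017, §3] -/
@[simp] theorem matrixOfCols_apply {α : Type*} [Zero α] (m n : ℕ) (cols : List (List α))
    (k : Fin m) (i : Fin n) : matrixOfCols m n cols k i = (cols.getD i.val []).getD k.val 0 := rfl

namespace PSD

open Finset

variable {n m : ℕ}

/-! ### List arithmetic with `getD`-default semantics -/

/-- `l.getD 0 x` is the head with default. [folklore] -/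
private theorem getD_zero_eq_headD {α : Type*} (l : List α) (x : α) : l.getD 0 x = l.headD x := by
  cases l with
  | nil => simp
  | cons a as => exact List.getD_cons_zero

/-- `l.getD (k+1) x` is `getD k` of the tail. [folklore] -/
private theorem getD_succ_eq_getD_tail {α : Type*} (l : List α) (k : ℕ) (x : α) :
    l.getD (k + 1) x = l.tail.getD k x := by
  cases l with
  | nil => simp
  | cons a as => exact List.getD_cons_succ

/-- Fuel-indexed dot product of two integer lists: `∑_{k < m} u_k · v_k` with missing entries
read as `0`. Structural recursion on the fuel (kernel-friendly). [folklore] -/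
def ldotZ : ℕ → List ℤ → List ℤ → ℤ
  | 0, _, _ => 0
  | m + 1, u, v => u.headD 0 * v.headD 0 + ldotZ m u.tail v.tail

/-- `ldotZ m u v = ∑ k : Fin m, u.getD k 0 * v.getD k 0`. [folklore] -/
private theorem ldotZ_eq_sum (m : ℕ) : ∀ u v : List ℤ,
    ldotZ m u v = ∑ k : Fin m, u.getD k.val 0 * v.getD k.val 0 := by
  induction m with
  | zero => intro u v; simp [ldotZ]
  | succ m ih =>
    intro u v
    rw [ldotZ, Fin.sum_univ_succ, ih]
    simp only [Fin.val_zero, Fin.val_succ, getD_zero_eq_headD, getD_succ_eq_getD_tail]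

/-- Entrywise product of a weight list with an integer list (truncating `zipWith`):
`lwmulZ d u = [d₀·u₀, d₁·u₁, …]`. [folklore] -/
def lwmulZ : List ℕ → List ℤ → List ℤ
  | d :: ds, u :: us => (d : ℤ) * u :: lwmulZ ds us
  | _, _ => []

/-- `(lwmulZ d u).getD k 0 = d.getD k 0 * u.getD k 0` (both sides vanish past either end).
[folklore] -/
private theorem getD_lwmulZ : ∀ (d : List ℕ) (u : List ℤ) (k : ℕ),
    (lwmulZ d u).getD k 0 = ((d.getD k 0 : ℕ) : ℤ) * u.getD k 0
  | [], u, k => by cases u <;> simp [lwmulZ]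
  | d :: ds, [], k => by simp [lwmulZ]
  | d :: ds, u :: us, 0 => by simp [lwmulZ]
  | d :: ds, u :: us, k + 1 => by
    simp only [lwmulZ, List.getD_cons_succ]
    exact getD_lwmulZ ds us k

/-! ### The row check -/

/-- The summand of the row test: `−r` on the diagonal (`j = i`), `|r|` off it, where
`r = a − ⟨w, c⟩` is the residual entry (`a` = entry of `A`, `w` = weighted column `i` of `B`,
`c` = column `j` of `B`). [folklore] -/
def rowTermZ (m : ℕ) (w : List ℤ) (i j : ℕ) (a : ℤ) (c : List ℤ) : ℤ :=
  if j = i then -(a - ldotZ m w c) else ((a - ldotZ m w c).natAbs : ℤ)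

/-- Fuel-indexed accumulation of `rowTermZ` along the row list of `A` and the column list of `B`,
starting at column index `j`. [folklore] -/
def rowAccZ (m : ℕ) (w : List ℤ) (i : ℕ) : ℕ → ℕ → List ℤ → List (List ℤ) → ℤ
  | 0, _, _, _ => 0
  | fuel + 1, j, arow, cols =>
      rowTermZ m w i j (arow.headD 0) (cols.headD []) +
        rowAccZ m w i fuel (j + 1) arow.tail cols.tail

/-- **The list-refined row check** for row `i` of the certificate `(Arows, d, BT)`:
`∑_{j < n} rowTermZ ≤ 0`, i.e. `∑_{j ≠ i} |R i j| ≤ R i i` for the residual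
`R = A − Bᵀ·diag d·B`, with the weighted column `lwmulZ d (BT i)` computed once. [folklore] -/
def rowCheckZ (n m : ℕ) (Arows : List (List ℤ)) (d : List ℕ) (BT : List (List ℤ)) (i : ℕ) :
    Bool :=
  decide (rowAccZ m (lwmulZ d (BT.getD i [])) i n 0 (Arows.getD i []) BT ≤ 0)

/-- `rowAccZ` is the `Fin fuel`-sum of `rowTermZ` at the shifted indices. [folklore] -/
private theorem rowAccZ_eq_sum (m : ℕ) (w : List ℤ) (i : ℕ) : ∀ (fuel j : ℕ) (arow : List ℤ)
    (cols : List (List ℤ)), rowAccZ m w i fuel j arow cols =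
      ∑ t : Fin fuel, rowTermZ m w i (j + t.val) (arow.getD t.val 0) (cols.getD t.val []) := by
  intro fuel
  induction fuel with
  | zero => intro j arow cols; simp [rowAccZ]
  | succ fuel ih =>
    intro j arow cols
    rw [rowAccZ, Fin.sum_univ_succ, ih]
    simp only [Fin.val_zero, Nat.add_zero, Fin.val_succ, getD_zero_eq_headD,
      getD_succ_eq_getD_tail]
    congr 1
    exact Finset.sum_congr rfl fun t _ => by rw [show j + (t.val + 1) = j + 1 + t.val by omega]

/-- The residual entry of the list-backed certificate is the list computation. [folklore] -/
private theorem gramResidualZ_list (Arows : List (List ℤ)) (d : List ℕ) (BT : List (List ℤ))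
    (i j : Fin n) :
    gramResidualZ (matrixOfRows n n Arows) (vecOfList m d) (matrixOfCols m n BT) i j =
      (Arows.getD i.val []).getD j.val 0 -
        ldotZ m (lwmulZ d (BT.getD i.val [])) (BT.getD j.val []) := by
  simp only [gramResidualZ, matrixOfRows_apply, vecOfList_apply, matrixOfCols_apply,
    ldotZ_eq_sum, getD_lwmulZ, mul_assoc]

/-- The Gram part `∑ k, d k · (B k i · B k j)` is symmetric in `(i, j)`, so the residual is
symmetric as soon as `A` is. [folklore] -/
private theorem gramResidualZ_symm_of_symm {A : Matrix (Fin n) (Fin n) ℤ} (d : Fin m → ℕ)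
    (B : Matrix (Fin m) (Fin n) ℤ) (hA : ∀ i j, A i j = A j i) (i j : Fin n) :
    gramResidualZ A d B i j = gramResidualZ A d B j i := by
  simp only [gramResidualZ]
  rw [hA i j]
  congr 1
  exact Finset.sum_congr rfl fun k _ => by ring

/-- **Soundness of the list-refined check (data refinement lemma).** If the rows of `A` are
symmetric (a `Fin`-statement over `List.getD` look-ups only) and every row passes `rowCheckZ`,
then the list-backed data form an integer rounded Gram certificate in the sense of
`PosSemidefInt.lean`; all consequences there (`IsGramCertZ.posSemidef`, `.quadForm_nonneg`,
`.posSemidef_of_smul`, …) follow. Data-refinement step [cite: MartinDorelRoux2017, §3]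
(«specialize the algorithms with effective datatypes and prove them correct with respect to the
proof-oriented datatypes»); the Gram-plus-dominant-residual mathematics is
[cite: BlekhermanParriloThomas2012, App. A.1.2] as in `PosSemidefInt.lean`. -/
theorem IsGramCertZ.of_listCheck {Arows : List (List ℤ)} {d : List ℕ} {BT : List (List ℤ)}
    (hsym : ∀ i j : Fin n, matrixOfRows n n Arows i j = matrixOfRows n n Arows j i)
    (hrows : ∀ i : Fin n, rowCheckZ n m Arows d BT i.val = true) :
    IsGramCertZ (matrixOfRows n n Arows) (vecOfList m d) (matrixOfCols m n BT) := by
  unfold IsGramCertZ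
  refine IsDiagDominantZ.intro
    (gramResidualZ_symm_of_symm (vecOfList m d) (matrixOfCols m n BT) hsym) fun i => ?_
  set R := gramResidualZ (matrixOfRows n n Arows) (vecOfList m d) (matrixOfCols m n BT) with hR
  have h := hrows i
  simp only [rowCheckZ, decide_eq_true_eq, rowAccZ_eq_sum, Nat.zero_add] at h
  -- identify the summands with `if j = i then -R i j else |R i j|`
  have hterm : ∀ j : Fin n, rowTermZ m (lwmulZ d (BT.getD i.val [])) i.val j.val
      ((Arows.getD i.val []).getD j.val 0) (BT.getD j.val []) =
        if j = i then -R i j else |R i j| := by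
    intro j
    rw [hR, gramResidualZ_list, rowTermZ, Int.natCast_natAbs]
    by_cases hji : j = i
    · simp [hji]
    · simp [hji, Fin.val_ne_of_ne hji]
  simp only [hterm] at h
  rw [← Finset.add_sum_erase _ _ (Finset.mem_univ i)] at h
  rw [if_pos rfl] at h
  have h2 : ∑ j ∈ Finset.univ.erase i, (if j = i then -R i j else |R i j|) =
      ∑ j ∈ Finset.univ.erase i, |R i j| :=
    Finset.sum_congr rfl fun j hj => by rw [if_neg (Finset.ne_of_mem_erase hj)]
  rw [h2] at h
  linarith

/-! ### List-refined symmetry check of `A`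

Deciding `∀ i j : Fin n, A i j = A j i` directly over `matrixOfRows` costs two `List.getD` walks
per pair (measured: ≈ 13 s of kernel time at `n = 84`). The check below transposes the row list
ONCE by structural recursion and compares row lists head-on (≈ 1 s at `n = 84`). -/

/-- The heads of all rows (default `0` for an empty row). [folklore] -/
def headsZ : List (List ℤ) → List ℤ
  | r :: rs => r.headD 0 :: headsZ rs
  | [] => []

/-- The tails of all rows. [folklore] -/
def tailsZ : List (List ℤ) → List (List ℤ)
  | r :: rs => r.tail :: tailsZ rs
  | [] => []

/-- The first `k` columns of a row list, as a list of `k` lists. [folklore] -/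
def colsN : ℕ → List (List ℤ) → List (List ℤ)
  | 0, _ => []
  | k + 1, rows => headsZ rows :: colsN k (tailsZ rows)

/-- `headsZ` lists the `0`-th entries (defaults as `List.getD`). [folklore] -/
private theorem getD_headsZ : ∀ (rows : List (List ℤ)) (i : ℕ),
    (headsZ rows).getD i 0 = (rows.getD i []).getD 0 0
  | [], i => by simp [headsZ]
  | r :: rs, 0 => by
    simp only [headsZ, List.getD_cons_zero]
    exact (getD_zero_eq_headD r 0).symm
  | r :: rs, i + 1 => by
    simp only [headsZ, List.getD_cons_succ]
    exact getD_headsZ rs i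

/-- `tailsZ` lists the tails. [folklore] -/
private theorem getD_tailsZ : ∀ (rows : List (List ℤ)) (i : ℕ),
    (tailsZ rows).getD i [] = (rows.getD i []).tail
  | [], i => by simp [tailsZ]
  | r :: rs, 0 => by simp [tailsZ]
  | r :: rs, i + 1 => by
    simp only [tailsZ, List.getD_cons_succ]
    exact getD_tailsZ rs i

/-- Column `j < k` of `colsN k rows` lists the `j`-th entries of the rows. [folklore] -/
private theorem getD_colsN : ∀ (k : ℕ) (rows : List (List ℤ)) (i j : ℕ), j < k →
    ((colsN k rows).getD j []).getD i 0 = (rows.getD i []).getD j 0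
  | 0, _, _, _, hj => absurd hj (Nat.not_lt_zero _)
  | k + 1, rows, i, 0, _ => by
    simp only [colsN, List.getD_cons_zero]
    exact getD_headsZ rows i
  | k + 1, rows, i, j + 1, hj => by
    simp only [colsN, List.getD_cons_succ]
    rw [getD_colsN k (tailsZ rows) i j (by omega), getD_tailsZ, getD_succ_eq_getD_tail]

/-- Fuel-indexed entrywise equality test of two integer lists on the first `k` entries
(defaults `0`). [folklore] -/
def eqRowN : ℕ → List ℤ → List ℤ → Bool
  | 0, _, _ => true
  | k + 1, u, v => decide (u.headD 0 = v.headD 0) && eqRowN k u.tail v.tail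

/-- Fuel-indexed equality test of two row lists on the first `k` rows and `c` columns.
[folklore] -/
def eqRowsN (c : ℕ) : ℕ → List (List ℤ) → List (List ℤ) → Bool
  | 0, _, _ => true
  | k + 1, X, Y => eqRowN c (X.headD []) (Y.headD []) && eqRowsN c k X.tail Y.tail

/-- A passing `eqRowN k` test gives entrywise equality below `k`. [folklore] -/
private theorem eqRowN_sound : ∀ (k : ℕ) (u v : List ℤ), eqRowN k u v = true →
    ∀ j, j < k → u.getD j 0 = v.getD j 0
  | 0, _, _, _, j, hj => absurd hj (Nat.not_lt_zero _)
  | k + 1, u, v, h, 0, _ => by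
    simp only [eqRowN, Bool.and_eq_true, decide_eq_true_eq] at h
    simpa only [getD_zero_eq_headD] using h.1
  | k + 1, u, v, h, j + 1, hj => by
    simp only [eqRowN, Bool.and_eq_true, decide_eq_true_eq] at h
    rw [getD_succ_eq_getD_tail, getD_succ_eq_getD_tail]
    exact eqRowN_sound k u.tail v.tail h.2 j (by omega)

/-- A passing `eqRowsN c k` test gives entrywise equality on the `k × c` window. [folklore] -/
private theorem eqRowsN_sound (c : ℕ) : ∀ (k : ℕ) (X Y : List (List ℤ)), eqRowsN c k X Y = true →
    ∀ i j, i < k → j < c → (X.getD i []).getD j 0 = (Y.getD i []).getD j 0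
  | 0, _, _, _, i, j, hi, _ => absurd hi (Nat.not_lt_zero _)
  | k + 1, X, Y, h, 0, j, _, hj => by
    simp only [eqRowsN, Bool.and_eq_true] at h
    rw [getD_zero_eq_headD, getD_zero_eq_headD]
    exact eqRowN_sound c _ _ h.1 j hj
  | k + 1, X, Y, h, i + 1, j, hi, hj => by
    simp only [eqRowsN, Bool.and_eq_true] at h
    rw [getD_succ_eq_getD_tail, getD_succ_eq_getD_tail]
    exact eqRowsN_sound c k X.tail Y.tail h.2 i j (by omega) hj

/-- **The list-refined symmetry check**: the `n × n` window of `Arows` equals that of its column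
list `colsN n Arows`. [folklore] -/
def symCheckZ (n : ℕ) (Arows : List (List ℤ)) : Bool :=
  eqRowsN n n Arows (colsN n Arows)

/-- **Soundness of `symCheckZ`** (data refinement of the symmetry test to list carriers): the
list-backed matrix is symmetric on its `n × n` window. [cite: MartinDorelRoux2017, §3] -/
theorem symm_of_symCheckZ {Arows : List (List ℤ)} (h : symCheckZ n Arows = true) :
    ∀ i j : Fin n, matrixOfRows n n Arows i j = matrixOfRows n n Arows j i := by
  intro i j
  simp only [matrixOfRows_apply]
  rw [eqRowsN_sound n n Arows (colsN n Arows) h i.val j.val i.isLt j.isLt]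
  exact getD_colsN n Arows j.val i.val i.isLt

/-- **Soundness, fully list-refined form**: `symCheckZ` and all `rowCheckZ` imply
`IsGramCertZ`. [cite: MartinDorelRoux2017, §3] (data refinement);
[cite: BlekhermanParriloThomas2012, App. A.1.2] (Gram certificates). -/
theorem IsGramCertZ.of_listCheck' {Arows : List (List ℤ)} {d : List ℕ} {BT : List (List ℤ)}
    (hsym : symCheckZ n Arows = true)
    (hrows : ∀ i : Fin n, rowCheckZ n m Arows d BT i.val = true) :
    IsGramCertZ (matrixOfRows n n Arows) (vecOfList m d) (matrixOfCols m n BT) :=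
  IsGramCertZ.of_listCheck (symm_of_symCheckZ hsym) hrows

/-! ### Usage template

```
-- data (emitted): `Arows`, `dList`, `BTcols` as `List` literals (type-ascribed inner lists)
theorem cert : PSD.IsGramCertZ (matrixOfRows 84 84 Arows) (vecOfList 84 dList)
    (matrixOfCols 84 84 BTcols) :=
  PSD.IsGramCertZ.of_listCheck' (by decide +kernel)             -- symmetry of A (list form)
    (forall_fin_of_blocks 12 (by norm_num)                      -- rows in blocks of 12,
      (by intro c; fin_cases c <;> decide +kernel))             -- or `(by decide +kernel)`
-- then e.g. `cert.posSemidef (R := ℝ)` or `GramSOS.quadNonneg_of_gramCertZ`.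
```
-/

/-! ### Tests (kernel-checked) -/

/-- Test: the `3 × 3` certificate of `PosSemidefInt.lean` in list form —
`A = [[200,-100,0],[-100,200,-100],[0,-100,200]]`, `d = (2, 1, 1)`, factor rows
`B = [[10,-5,0],[0,10,-7],[0,0,10]]`, hence COLUMNS `[[10,0,0],[-5,10,0],[0,-7,10]]`. -/
example : IsGramCertZ (matrixOfRows 3 3 [[200, -100, 0], [-100, 200, -100], [0, -100, 200]])
    (vecOfList 3 [2, 1, 1]) (matrixOfCols 3 3 [[10, 0, 0], [-5, 10, 0], [0, -7, 10]]) :=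
  IsGramCertZ.of_listCheck (by decide +kernel) (by decide +kernel)

/-- Test: the same, rows in blocks of `2` (the shape used for large certificates), and the
`Matrix.PosSemidef` consequence over `ℝ`. -/
example : ((matrixOfRows 3 3 [[200, -100, 0], [-100, 200, -100], [0, -100, 200]] :
      Matrix (Fin 3) (Fin 3) ℤ).map (Int.cast : ℤ → ℝ)).PosSemidef :=
  have hc : IsGramCertZ (matrixOfRows 3 3 [[200, -100, 0], [-100, 200, -100], [0, -100, 200]])
      (vecOfList 3 [2, 1, 1]) (matrixOfCols 3 3 [[10, 0, 0], [-5, 10, 0], [0, -7, 10]]) :=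
    IsGramCertZ.of_listCheck (by decide +kernel)
      (forall_fin_of_blocks 2 (by norm_num) (by intro c; fin_cases c <;> decide +kernel))
  hc.posSemidef

/-- Test: the fully list-refined form (`symCheckZ` + `rowCheckZ`, one `decide` each). -/
example : IsGramCertZ (matrixOfRows 3 3 [[200, -100, 0], [-100, 200, -100], [0, -100, 200]])
    (vecOfList 3 [2, 1, 1]) (matrixOfCols 3 3 [[10, 0, 0], [-5, 10, 0], [0, -7, 10]]) :=
  IsGramCertZ.of_listCheck' (by decide +kernel) (by decide +kernel)

/-- Test: a non-symmetric `A` is rejected by `symCheckZ`. -/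
example : symCheckZ 2 [[1, 2], [3, 1]] = false := by decide +kernel

/-- Test: a failing row is rejected (residual row `[0, 50, -60]`: `60 > 50`). -/
example : rowCheckZ 3 3 [[200, -100, 0], [-100, 200, -130], [0, -130, 200]] [2, 1, 1]
    [[10, 0, 0], [-5, 10, 0], [0, -7, 10]] 1 = false := by decide +kernel

end PSD

end Literature.Computation.Certificates
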